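import Summits.Ventures.CertifiedManyBodySolver.Transport.D4VecAction
import HarnessLib

/-!
# Ventures/CertifiedManyBodySolver — Transport/D4VecActionRange.lean

HONEST FRAMING: first certified bounds on pairing observables; not a superconductivity verdict; every number certified or
labelled float. (hubbard-obs cell, obs-lit seat g2; zero compute, no certificate, no state class, no definition, no named fact.)

**`D₄`-orbit sums at an ARBITRARY displacement `v ∈ ℤ²`** — the eight-term expansion
`Σ_{g∈D₄} F(g·v) = F(v₀,v₁) + F(−v₁,v₀) + F(−v₀,−v₁) + F(v₁,−v₀) + F(v₀,−v₁) + F(−v₁,−v₀) + F(−v₀,v₁) + F(v₁,v₀)`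
(`sum_univ_d4Vec_expand`, from `sum_univ_dihedralFour` and the coordinate forms `d4Vec_*_apply` of
`Transport/D4VecAction.lean`), its numeral form `sum_univ_d4Vec_pair a b`, and the real `2 * (…)` forms on the AXIS
`(k, 0)` and the DIAGONAL `(k, k)` classes for every `k : ℤ` (`d4_sum_axis`, `d4_sum_diag`; `D4VecAction` has `k = 1`:
`d4_sum_e1`, `d4_sum_d1`) plus the generic class `(a, b)` (`d4_sum_pair`). Consumed by the `D₄`-ORBIT-MEAN readings of the
rung-0b pair-correlator rows AT RANGE (`P̄_d(2,1)`, `P̄_d(2,2)`, `P̄_d(3,0)`: orbit cells `M3CorrOrbitLowerRow … Finset.univ …`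
on the two-point pair word, `Observables/PairWordD4.lean`), exactly as `d4_sum_e1 / d4_sum_d1` serve the site-sharing rows
(`Certificates/HubbardSquare_corr_pd10_pd11_tp0_rows_j240287.lean`).
References: D. J. Scalapino, Phys. Rep. 250 (1995) 329, §2 [Scalapino1995]; Mathlib `GroupTheory/SpecificGroups/Dihedral`.
-/

namespace Summit.Ventures.CertifiedManyBodySolver.Transport

open Literature.MathematicalPhysics.QuantumLattice Literature.Probability.LatticeModels
open DihedralGroup
open scoped BigOperators

section OrbitSumsRange

variable {M : Type*} [AddCommMonoid M]

/-- **Eight-term expansion of a `D₄`-orbit sum at any `v ∈ ℤ²`**, in coordinates: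
`Σ_g F(g·v) = F v + F(−v₁,v₀) + F(−v₀,−v₁) + F(v₁,−v₀) + F(v₀,−v₁) + F(−v₁,−v₀) + F(−v₀,v₁) + F(v₁,v₀)`
(order `1, r, r², r³, s, sr, sr², sr³`). [cite: Scalapino1995, §2] -/
theorem sum_univ_d4Vec_expand (F : Site 2 → M) (v : Site 2) :
    ∑ g : DihedralGroup 4, F (d4Vec g v) =
      F v + F ![-v 1, v 0] + F ![-v 0, -v 1] + F ![v 1, -v 0] +
        F ![v 0, -v 1] + F ![-v 1, -v 0] + F ![-v 0, v 1] + F ![v 1, v 0] := by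
  rw [sum_univ_dihedralFour, show d4Vec 1 v = v from rfl, d4Vec_r_one_apply, d4Vec_r_two_apply, d4Vec_r_three_apply,
    d4Vec_sr_zero_apply, d4Vec_sr_one_apply, d4Vec_sr_two_apply, d4Vec_sr_three_apply]

/-- Numeral form: `Σ_g F(g·(a,b)) = F(a,b) + F(−b,a) + F(−a,−b) + F(b,−a) + F(a,−b) + F(−b,−a) + F(−a,b) + F(b,a)`.
[cite: Scalapino1995, §2] -/
theorem sum_univ_d4Vec_pair (F : Site 2 → M) (a b : ℤ) :
    ∑ g : DihedralGroup 4, F (d4Vec g ![a, b]) =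
      F ![a, b] + F ![-b, a] + F ![-a, -b] + F ![b, -a] +
        F ![a, -b] + F ![-b, -a] + F ![-a, b] + F ![b, a] := by
  rw [sum_univ_d4Vec_expand]
  rfl

end OrbitSumsRange

section RealOrbitSumsRange

/-- **Axis class `(k, 0)`** over the reals: `Σ_g F(g·(k,0)) = 2·(F(k,0) + F(−k,0) + F(0,k) + F(0,−k))` for every `k : ℤ`
(`k = 1` is `d4_sum_e1`; `k = 2, 3` serve `P̄_d(2,0)`, `P̄_d(3,0)`). [cite: Scalapino1995, §2] -/
theorem d4_sum_axis (F : Site 2 → ℝ) (k : ℤ) :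
    ∑ g : DihedralGroup 4, F (d4Vec g ![k, 0]) = 2 * (F ![k, 0] + F ![-k, 0] + F ![0, k] + F ![0, -k]) := by
  rw [sum_univ_d4Vec_pair]
  simp only [neg_zero]
  ring

/-- **Diagonal class `(k, k)`** over the reals: `Σ_g F(g·(k,k)) = 2·(F(k,k) + F(−k,−k) + F(−k,k) + F(k,−k))` for every `k : ℤ`
(`k = 1` is `d4_sum_d1`; `k = 2` serves `P̄_d(2,2)`). [cite: Scalapino1995, §2] -/
theorem d4_sum_diag (F : Site 2 → ℝ) (k : ℤ) :
    ∑ g : DihedralGroup 4, F (d4Vec g ![k, k]) = 2 * (F ![k, k] + F ![-k, -k] + F ![-k, k] + F ![k, -k]) := by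
  rw [sum_univ_d4Vec_pair]
  ring

/-- **Generic class `(a, b)`** over the reals (eight points when `a ≠ ±b`, `ab ≠ 0`, e.g. `(2,1)` for `P̄_d(2,1)`):
`Σ_g F(g·(a,b)) = F(a,b) + F(−b,a) + F(−a,−b) + F(b,−a) + F(a,−b) + F(−b,−a) + F(−a,b) + F(b,a)`. [cite: Scalapino1995, §2] -/
theorem d4_sum_pair (F : Site 2 → ℝ) (a b : ℤ) :
    ∑ g : DihedralGroup 4, F (d4Vec g ![a, b]) =
      F ![a, b] + F ![-b, a] + F ![-a, -b] + F ![b, -a] + F ![a, -b] + F ![-b, -a] + F ![-a, b] + F ![b, a] :=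
  sum_univ_d4Vec_pair F a b

/-- The `(2,1)` class written with numerals: the eight displacements `(±2,±1)`, `(±1,±2)`. [cite: Scalapino1995, §2] -/
theorem d4_sum_v21 (F : Site 2 → ℝ) :
    ∑ g : DihedralGroup 4, F (d4Vec g ![2, 1]) =
      F ![2, 1] + F ![-1, 2] + F ![-2, -1] + F ![1, -2] + F ![2, -1] + F ![-1, -2] + F ![-2, 1] + F ![1, 2] := by
  rw [d4_sum_pair]

/-- The `(2,2)` class: `Σ_g F(g·(2,2)) = 2·(F(2,2) + F(−2,−2) + F(−2,2) + F(2,−2))`. [cite: Scalapino1995, §2] -/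
theorem d4_sum_v22 (F : Site 2 → ℝ) :
    ∑ g : DihedralGroup 4, F (d4Vec g ![2, 2]) = 2 * (F ![2, 2] + F ![-2, -2] + F ![-2, 2] + F ![2, -2]) := by
  rw [d4_sum_diag]

/-- The `(2,0)` class: `Σ_g F(g·(2,0)) = 2·(F(2,0) + F(−2,0) + F(0,2) + F(0,−2))`. [cite: Scalapino1995, §2] -/
theorem d4_sum_v20 (F : Site 2 → ℝ) :
    ∑ g : DihedralGroup 4, F (d4Vec g ![2, 0]) = 2 * (F ![2, 0] + F ![-2, 0] + F ![0, 2] + F ![0, -2]) := by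
  rw [d4_sum_axis]

/-- The `(3,0)` class: `Σ_g F(g·(3,0)) = 2·(F(3,0) + F(−3,0) + F(0,3) + F(0,−3))`. [cite: Scalapino1995, §2] -/
theorem d4_sum_v30 (F : Site 2 → ℝ) :
    ∑ g : DihedralGroup 4, F (d4Vec g ![3, 0]) = 2 * (F ![3, 0] + F ![-3, 0] + F ![0, 3] + F ![0, -3]) := by
  rw [d4_sum_axis]

end RealOrbitSumsRange

end Summit.Ventures.CertifiedManyBodySolver.Transport
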